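import Literature.Analysis.ODE.OutgoingVariationOfParameters
import HarnessLib

/-!
# The horizon amplitude of the outgoing solution of `u″ + φ u = H`:
# `𝔚² · lim_{x → −∞} |u(x)|² = ℓ² · |∫ u_I H|² ≤ ℓ² P² (∫|H|)²`

Topic `Literature/Analysis/ODE` (namespace `Literature.Analysis.ODE`); companion of
`OutgoingVariationOfParameters.lean`. In the setting of the Green representation
`𝔚·u(x) = u_I(x)∫_{(−∞,x]} u_H H + u_H(x)∫_{(x,∞)} u_I H` (`outgoing_wronskian_mul_eq`: two global
solutions `u_H`, `u_I` of `y″ = −φy` with Wronskian `𝔚 ≠ 0`, `u_H` bounded and ingoing toward `−∞`,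
`u_I` bounded and outgoing toward `+∞`; `u` an outgoing solution of `u″ + φu = H`, `H ∈ L¹ ∩ C⁰`),
assume moreover that `u_I` is GLOBALLY bounded, `‖u_I‖ ≤ P` on `ℝ`, that `‖u_H(x)‖ → ℓ` as `x → −∞`
(the horizon normalisation, `ℓ = 1`) and that `‖u(x)‖² → A` as `x → −∞` (the horizon amplitude of
DRSR's outgoing solutions, arXiv:1402.7034 (eq:b−)). Then, letting `x → −∞` in the representation
(`∫_{(−∞,x]} u_H H → 0`, `∫_{(x,∞)} u_I H → ∫_ℝ u_I H`),

* `outgoing_wronskian_sq_mul_amplitude_eq` — `‖𝔚‖²·A = ℓ²·‖∫_ℝ u_I H‖²`;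
* `outgoing_wronskian_sq_mul_amplitude_le` — `‖𝔚‖²·A ≤ ℓ²·(P ∫‖H‖)²`.

This is the "horizon term through the representation" of DRSR §9.7 / Prop. 9.7.1: with a LOWER bound
`|𝔚|⁻² ≤ G` (quantitative mode stability) it gives `A ≤ G ℓ² P² (∫|H|)²`. Everything is proved;
folklore given the representation.

## References
* M. Dafermos, I. Rodnianski, Y. Shlapentokh-Rothman, arXiv:1402.7034 = Ann. of Math. 183 (2016),
  §9.7, Prop. 9.7.1. [DafermosRodnianskiShlapentokhrothman2014]
* Y. Shlapentokh-Rothman, Ann. Henri Poincaré 16 (2015) 289–345 (quantitative mode stability and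
  the horizon term). [ShlapentokhRothman2015ModeStability]
-/

noncomputable section

open Set Filter MeasureTheory Topology

namespace Literature.Analysis.ODE

variable {φ : ℝ → ℝ} {uH uH' uI uI' u u₁ u₂ H : ℝ → ℂ} {α β : ℂ}

/-- **The horizon amplitude through the representation (equality).** Under the hypotheses of
`outgoing_wronskian_mul_eq`, a global envelope `‖u_I‖ ≤ P`, `‖u_H(x)‖ → ℓ` and `‖u(x)‖² → A` as
`x → −∞`: `‖𝔚‖²·A = ℓ²·‖∫_ℝ u_I H‖²` (let `x → −∞` in `𝔚u = u_I∫_{−∞}^x u_H H + u_H∫_x^∞ u_I H`).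
[cite: DafermosRodnianskiShlapentokhrothman2014, Prop. 9.7.1] -/
theorem outgoing_wronskian_sq_mul_amplitude_eq
    (hH : ∀ x, HasDerivAt uH (uH' x) x ∧ HasDerivAt uH' (-((φ x : ℂ) * uH x)) x)
    (hI : ∀ x, HasDerivAt uI (uI' x) x ∧ HasDerivAt uI' (-((φ x : ℂ) * uI x)) x)
    (hW : uH 0 * uI' 0 - uH' 0 * uI 0 ≠ 0)
    (hHb : IsBoundedUnder (· ≤ ·) atBot fun x ↦ ‖uH x‖)
    (hIb : IsBoundedUnder (· ≤ ·) atTop fun x ↦ ‖uI x‖)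
    (hHo : Tendsto (fun x ↦ uH' x + α * uH x) atBot (𝓝 0))
    (hIo : Tendsto (fun x ↦ uI' x - β * uI x) atTop (𝓝 0))
    (hu : ∀ x, HasDerivAt u (u₁ x) x) (hu₁ : ∀ x, HasDerivAt u₁ (u₂ x) x)
    (hode : ∀ x, u₂ x + (φ x : ℂ) * u x = H x) (hHc : Continuous H) (hHi : Integrable H)
    (hub : IsBoundedUnder (· ≤ ·) atBot fun x ↦ ‖u x‖)
    (hut : IsBoundedUnder (· ≤ ·) atTop fun x ↦ ‖u x‖)
    (huo_bot : Tendsto (fun x ↦ u₁ x + α * u x) atBot (𝓝 0))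
    (huo_top : Tendsto (fun x ↦ u₁ x - β * u x) atTop (𝓝 0))
    {P ℓ A : ℝ} (hP : ∀ x, ‖uI x‖ ≤ P) (hℓ : Tendsto (fun x ↦ ‖uH x‖) atBot (𝓝 ℓ))
    (hA : Tendsto (fun x ↦ ‖u x‖ ^ 2) atBot (𝓝 A)) :
    ‖uH 0 * uI' 0 - uH' 0 * uI 0‖ ^ 2 * A = ℓ ^ 2 * ‖∫ y, uI y * H y‖ ^ 2 := by
  set W : ℂ := uH 0 * uI' 0 - uH' 0 * uI 0 with hWdef
  have hrep := outgoing_wronskian_mul_eq hH hI hW hHb hIb hHo hIo hu hu₁ hode hHc hHi hub hut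
    huo_bot huo_top
  have hHc' : Continuous uH := continuous_iff_continuousAt.2 fun t ↦ (hH t).1.continuousAt
  have hIc' : Continuous uI := continuous_iff_continuousAt.2 fun t ↦ (hI t).1.continuousAt
  -- integrability of `u_I H` on ℝ and of `u_H H` on left half-lines
  have hiI : Integrable (fun y ↦ uI y * H y) := by
    have h := integrableOn_mul_of_norm_le hIc' hHc hHi MeasurableSet.univ fun y _ ↦ hP y
    rwa [integrableOn_univ] at h
  have hiH : ∀ b, IntegrableOn (fun y ↦ uH y * H y) (Iic b) := fun b ↦ by
    obtain ⟨B, hB⟩ := exists_bound_Iic_of_isBoundedUnder hHc' hHb b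
    exact integrableOn_mul_of_norm_le hHc' hHc hHi measurableSet_Iic fun y hy ↦ hB y hy
  set g : ℂ := ∫ y, uI y * H y with hgdef
  -- the two half-line integrals at `−∞`
  have hF : Tendsto (fun x ↦ ∫ y in Iic x, uH y * H y) atBot (𝓝 0) :=
    tendsto_integral_Iic_atBot_of_integrableOn hiH
  have hG : Tendsto (fun x ↦ ∫ y in Ioi x, uI y * H y) atBot (𝓝 g) := by
    have h1 : Tendsto (fun x ↦ ∫ y in Iic x, uI y * H y) atBot (𝓝 0) :=
      tendsto_integral_Iic_atBot_of_integrableOn fun b ↦ hiI.integrableOn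
    have h2 : Tendsto (fun x ↦ g - ∫ y in Iic x, uI y * H y) atBot (𝓝 (g - 0)) :=
      tendsto_const_nhds.sub h1
    rw [sub_zero] at h2
    refine h2.congr fun x ↦ ?_
    rw [hgdef, ← intervalIntegral.integral_Iic_add_Ioi (b := x) hiI.integrableOn hiI.integrableOn]
    ring
  -- `𝔚 u(x) − u_H(x) g → 0`
  have hdiff : Tendsto (fun x ↦ W * u x - uH x * g) atBot (𝓝 0) := by
    have h1 : Tendsto (fun x ↦ uI x * ∫ y in Iic x, uH y * H y) atBot (𝓝 0) := by
      exact Filter.isBoundedUnder_le_mul_tendsto_zero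
        (Filter.isBoundedUnder_of ⟨P, fun x ↦ show ‖uI x‖ ≤ P from hP x⟩) hF
    have h2 : Tendsto (fun x ↦ uH x * ((∫ y in Ioi x, uI y * H y) - g)) atBot (𝓝 0) := by
      refine Filter.isBoundedUnder_le_mul_tendsto_zero hHb ?_
      have := hG.sub (tendsto_const_nhds (x := g))
      rwa [sub_self] at this
    have h3 := h1.add h2
    rw [add_zero] at h3
    refine h3.congr fun x ↦ ?_
    rw [hrep x]
    ring
  -- hence `‖𝔚 u(x)‖ → ℓ‖g‖`
  have hn1 : Tendsto (fun x ↦ ‖uH x * g‖) atBot (𝓝 (ℓ * ‖g‖)) := by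
    have h := hℓ.mul (tendsto_const_nhds (x := ‖g‖))
    exact h.congr fun x ↦ (norm_mul _ _).symm
  have hn2 : Tendsto (fun x ↦ ‖W * u x‖) atBot (𝓝 (ℓ * ‖g‖)) := by
    have hd : Tendsto (fun x ↦ ‖W * u x‖ - ‖uH x * g‖) atBot (𝓝 0) := by
      refine squeeze_zero_norm (fun x ↦ ?_) (tendsto_zero_iff_norm_tendsto_zero.1 hdiff)
      rw [Real.norm_eq_abs]
      exact abs_norm_sub_norm_le _ _
    have h := hn1.add hd
    rw [add_zero] at h
    exact h.congr fun x ↦ by ring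
  -- compare the two limits of `‖𝔚‖²‖u(x)‖²`
  have hL1 : Tendsto (fun x ↦ ‖W‖ ^ 2 * ‖u x‖ ^ 2) atBot (𝓝 (‖W‖ ^ 2 * A)) := hA.const_mul _
  have hL2 : Tendsto (fun x ↦ ‖W‖ ^ 2 * ‖u x‖ ^ 2) atBot (𝓝 ((ℓ * ‖g‖) ^ 2)) := by
    refine (hn2.pow 2).congr fun x ↦ ?_
    rw [norm_mul, mul_pow]
  have h := tendsto_nhds_unique hL1 hL2
  rw [h]
  ring

/-- **The horizon amplitude through the representation (bound).** Under the same hypotheses,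
`‖𝔚‖²·A ≤ ℓ²·(P ∫‖H‖)²` (`‖∫ u_I H‖ ≤ P∫‖H‖`). With quantitative mode stability `|𝔚|⁻² ≤ G` this is
DRSR's bound of the horizon term `|u(−∞)|² ≤ G ℓ² P² (∫|H|)²` of Prop. 9.7.1.
[cite: DafermosRodnianskiShlapentokhrothman2014, Prop. 9.7.1] -/
theorem outgoing_wronskian_sq_mul_amplitude_le
    (hH : ∀ x, HasDerivAt uH (uH' x) x ∧ HasDerivAt uH' (-((φ x : ℂ) * uH x)) x)
    (hI : ∀ x, HasDerivAt uI (uI' x) x ∧ HasDerivAt uI' (-((φ x : ℂ) * uI x)) x)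
    (hW : uH 0 * uI' 0 - uH' 0 * uI 0 ≠ 0)
    (hHb : IsBoundedUnder (· ≤ ·) atBot fun x ↦ ‖uH x‖)
    (hIb : IsBoundedUnder (· ≤ ·) atTop fun x ↦ ‖uI x‖)
    (hHo : Tendsto (fun x ↦ uH' x + α * uH x) atBot (𝓝 0))
    (hIo : Tendsto (fun x ↦ uI' x - β * uI x) atTop (𝓝 0))
    (hu : ∀ x, HasDerivAt u (u₁ x) x) (hu₁ : ∀ x, HasDerivAt u₁ (u₂ x) x)
    (hode : ∀ x, u₂ x + (φ x : ℂ) * u x = H x) (hHc : Continuous H) (hHi : Integrable H)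
    (hub : IsBoundedUnder (· ≤ ·) atBot fun x ↦ ‖u x‖)
    (hut : IsBoundedUnder (· ≤ ·) atTop fun x ↦ ‖u x‖)
    (huo_bot : Tendsto (fun x ↦ u₁ x + α * u x) atBot (𝓝 0))
    (huo_top : Tendsto (fun x ↦ u₁ x - β * u x) atTop (𝓝 0))
    {P ℓ A : ℝ} (hP : ∀ x, ‖uI x‖ ≤ P) (hℓ : Tendsto (fun x ↦ ‖uH x‖) atBot (𝓝 ℓ))
    (hA : Tendsto (fun x ↦ ‖u x‖ ^ 2) atBot (𝓝 A)) :
    ‖uH 0 * uI' 0 - uH' 0 * uI 0‖ ^ 2 * A ≤ ℓ ^ 2 * (P * ∫ y, ‖H y‖) ^ 2 := by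
  rw [outgoing_wronskian_sq_mul_amplitude_eq hH hI hW hHb hIb hHo hIo hu hu₁ hode hHc hHi hub hut
    huo_bot huo_top hP hℓ hA]
  have hIc' : Continuous uI := continuous_iff_continuousAt.2 fun t ↦ (hI t).1.continuousAt
  have hP0 : 0 ≤ P := (norm_nonneg _).trans (hP 0)
  have hiI : Integrable (fun y ↦ uI y * H y) := by
    have h := integrableOn_mul_of_norm_le hIc' hHc hHi MeasurableSet.univ fun y _ ↦ hP y
    rwa [integrableOn_univ] at h
  have hg : ‖∫ y, uI y * H y‖ ≤ P * ∫ y, ‖H y‖ := by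
    calc ‖∫ y, uI y * H y‖ ≤ ∫ y, ‖uI y * H y‖ := norm_integral_le_integral_norm _
      _ ≤ ∫ y, P * ‖H y‖ := by
          refine integral_mono hiI.norm (hHi.norm.const_mul P) fun y ↦ ?_
          rw [norm_mul]
          exact mul_le_mul_of_nonneg_right (hP y) (norm_nonneg _)
      _ = P * ∫ y, ‖H y‖ := integral_const_mul _ _
  have h0 : 0 ≤ ‖∫ y, uI y * H y‖ := norm_nonneg _
  exact mul_le_mul_of_nonneg_left (pow_le_pow_left₀ h0 hg 2) (sq_nonneg ℓ)

end Literature.Analysis.ODE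

end
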